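import Literature.AnabelianGeometry.SemiGraphs.MetabelianLeafStarEscapeSelfMaximal
import Literature.AnabelianGeometry.SemiGraphs.MetabelianLeafStarLinearCharacters
import Literature.AnabelianGeometry.SemiGraphs.MetabelianLeafStarAnchored
import Literature.AnabelianGeometry.SemiGraphs.TreeFixedLociBridge
import Literature.AnabelianGeometry.SemiGraphs.TemperedPiDecompositionLevelStab
import Literature.AnabelianGeometry.SemiGraphs.TemperedPiPointSeqThroughVertex
import Literature.AnabelianGeometry.SemiGraphs.Pullback
import HarnessLib

/-!
# The exotic maximal compact `⟨c⟩‾ ≅ ℤ_p` of `π₁^temp(𝒢⋆(p))` is ISOLATED: it meets every other maximal compact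
# subgroup trivially («C₀-ISOLATED@RAYLESS-STAR», file F3 — [SemiAnbd] Thm 3.7 (iv), second sentence, AT `C₀`)

Mochizuki, *Semi-graphs of anabelioids*, Publ. RIMS **42** (2006), §3, Theorem 3.7 (iv), manuscript p. 41:
"the maximal compact subgroups of `π₁^temp(𝒢)` are precisely the verticial subgroups of `π₁^temp(𝒢)`; the
nontrivial edge-like subgroups of `π₁^temp(𝒢)` are precisely the nontrivial intersections of distinct maximal
compact subgroups" — Lemma 1.8 (ii) p. 20 — Remark 2.2.1 p. 24 [cite: MochizukiSemiAnbd2006, Thm 3.7(iv) p.41].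

PROOF-ONLY file (no definition, no named fact; abc-iut cell, layer L3, row «C₀-ISOLATED@RAYLESS-STAR», L3-lead
gen 8 δ14 (3); seat abc-iut-L3-t8 gen 8 — the successor question BANKED by gen 7, "is `⟨c⟩‾` the ONLY maximal
compact subgroup of `π₁^temp(𝒢⋆(p))` meeting `⟨c⟩‾` non-trivially?", the hinge for Cor. 3.9 (b) at the star).
Canonical chart of the rayless star `𝒢⋆(p) = metabelianLeafStar p`, escaping element `c` of `exists_escapeLimit`,
`C₀ := ⟨c⟩‾` (compact procyclic, in NO verticial subgroup — file A p497672 —, ITSELF maximal compact — B2 p499850).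

**`mem_escape_of_commute_of_mem`**: every `k` generating a compact procyclic subgroup and COMMUTING with some
`d ∈ C₀ ∖ 1` lies in `C₀`; hence **`le_escape_of_isCompact_of_inf_ne_bot`**: every compact `K` with `K ⊓ C₀ ≠ 1`
lies in `C₀`, and (iv) SENTENCE 2 AT `C₀`: a maximal compact `K ≠ C₀` meets `C₀` TRIVIALLY
(`inf_escape_eq_bot_of_isMaximalCompactSubgroup_of_ne`).  ANSWER to gen 7's question: YES.
Proof (two-level TREE BRIDGE; no centraliser computation, no normal forms): (1) CERTIFICATE (file F1,
`exists_level_forall_edgeMap_ne`): for every base edge `n`, from some level `M₀(n)` on, `d` fixes NO tree edge of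
`𝒢_{∞,M}` over `n`.  (2) Fix a level `m`; if `ρ_m(k)`, `ρ_m(c)` had NO common fixed vertex (each fixes vertices,
Lemma 1.8 (ii)(a)), the bridge lemma of file F2 (`SemiGraph.exists_edge_forall_walk_mem_support`) gives an edge
`e₀` of `𝒢_{∞,m}` on EVERY walk from a `ρ_m(k)`-fixed to a `ρ_m(c)`-fixed vertex; with `n₀` its base edge and
`M ≥ m, M₀(n₀)`: the commuting compact `k`, `d` fix a COMMON vertex `v` of `𝒢_{∞,M}` (`⟨k, d⟩‾` is compact), `C₀`
fixes some `w`, the geodesic `[v, w]` is fixed node-wise by `d` (Lemma 1.8 (ii)(b)), and its image in `𝒢_{∞,m}`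
runs from the `ρ_m(k)`-fixed `π(v)` to the `ρ_m(c)`-fixed `π(w)`, hence through `e₀` — an edge of `[v, w]`, FIXED
BY `d`, over `n₀`: contradiction.  (3) So `⟨ρ_m(k), ρ_m(c)⟩` lies in a vertex-stabiliser image (abc-iut-L3-t6's
`fixes_vertex_iff_exists_gal`), finite; the closed subgroup `⟨k, c⟩‾` has finite level images, is COMPACT
(`isCompact_of_isClosed_of_forall_finite_image`), contains `C₀`, so EQUALS `C₀` by B2 (`le_escape_of_isCompact_of_ge`).
For compact `K` with `K ⊓ C₀ ∋ d ≠ 1`: `K` is in no verticial subgroup (`C₀` is anchor-free, abc-iut-w6-d064's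
`metabelianLeafStar_inf_verticial_eq_bot_of_forall_not_le`), hence COMMUTATIVE (w6-d064's dichotomy): apply (3).
Honest framing: OUR typed tempered fundamental group of OUR countable carrier `𝒢⋆(p)`; print's Thm 3.7 (iv) at
finite `𝔾` untouched; nothing here bears on [IUTchIII] Cor. 3.12; no side taken; typed ≠ proved.
-/

noncomputable section

open CategoryTheory Topology Multiplicative Filter
open scoped Pointwise
namespace Literature.AnabelianGeometry.SemiGraphs

open IwahoriWitness
universe u

/-! ### Generic: the closed subgroup generated by two commuting compact-generating elements is compact -/

/-- In a Hausdorff topological group, if `k` and `d` commute and each generates a compact procyclic closed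
subgroup, then the closed subgroup generated by `{k, d}` is compact (it lies in the compact product set
`⟨k⟩‾ · ⟨d⟩‾`, whose factors commute elementwise). [cite: MochizukiSemiAnbd2006, Lem. 1.8(ii)(a) p.20] -/
theorem isCompact_topologicalClosure_closure_pair_of_commute {G : Type*} [Group G] [TopologicalSpace G]
    [IsTopologicalGroup G] [T2Space G] {k d : G}
    (hk : IsCompact ((Subgroup.zpowers k).topologicalClosure : Set G))
    (hd : IsCompact ((Subgroup.zpowers d).topologicalClosure : Set G)) (hkd : k * d = d * k) :
    IsCompact ((Subgroup.closure ({k, d} : Set G)).topologicalClosure : Set G) := by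
  have hc : Commute k d := hkd
  -- elements of `⟨k⟩‾` commute with elements of `⟨d⟩‾`
  have h1 : ∀ y ∈ Subgroup.zpowers d, ∀ x ∈ (Subgroup.zpowers k).topologicalClosure, x * y = y * x := by
    intro y hy
    obtain ⟨j, rfl⟩ := Subgroup.mem_zpowers_iff.mp hy
    have hcl : IsClosed {x : G | x * d ^ j = d ^ j * x} :=
      isClosed_eq (continuous_id.mul continuous_const) (continuous_const.mul continuous_id)
    have hsub : ((Subgroup.zpowers k : Subgroup G) : Set G) ⊆ {x : G | x * d ^ j = d ^ j * x} := by
      intro x hx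
      obtain ⟨i, rfl⟩ := Subgroup.mem_zpowers_iff.mp hx
      exact (hc.zpow_zpow i j).eq
    exact fun x hx => closure_minimal hsub hcl (by rw [← Subgroup.topologicalClosure_coe]; exact hx)
  have hcomm : ∀ x ∈ (Subgroup.zpowers k).topologicalClosure, ∀ y ∈ (Subgroup.zpowers d).topologicalClosure,
      x * y = y * x := by
    intro x hx y hy
    have hcl : IsClosed {y : G | x * y = y * x} :=
      isClosed_eq (continuous_const.mul continuous_id) (continuous_id.mul continuous_const)
    have hsub : ((Subgroup.zpowers d : Subgroup G) : Set G) ⊆ {y : G | x * y = y * x} := fun y hy => h1 y hy x hx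
    exact closure_minimal hsub hcl (by rw [← Subgroup.topologicalClosure_coe]; exact hy)
  -- the compact set `⟨k⟩‾ · ⟨d⟩‾` contains the subgroup generated by `k`, `d`
  have hS : IsCompact (((Subgroup.zpowers k).topologicalClosure : Set G) *
      ((Subgroup.zpowers d).topologicalClosure : Set G)) := hk.mul hd
  have hsub : ((Subgroup.closure ({k, d} : Set G) : Subgroup G) : Set G) ⊆
      ((Subgroup.zpowers k).topologicalClosure : Set G) * ((Subgroup.zpowers d).topologicalClosure : Set G) := by
    intro x hx
    induction hx using Subgroup.closure_induction with
    | mem x hx =>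
      rcases hx with rfl | rfl
      · exact Set.mem_mul.mpr ⟨x, Subgroup.le_topologicalClosure _ (Subgroup.mem_zpowers x), 1,
          Subgroup.one_mem _, mul_one x⟩
      · exact Set.mem_mul.mpr ⟨1, Subgroup.one_mem _, x,
          Subgroup.le_topologicalClosure _ (Subgroup.mem_zpowers x), one_mul x⟩
    | one => exact Set.mem_mul.mpr ⟨1, Subgroup.one_mem _, 1, Subgroup.one_mem _, mul_one 1⟩
    | mul x y _ _ hx hy =>
      obtain ⟨a₁, ha₁, b₁, hb₁, rfl⟩ := Set.mem_mul.mp hx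
      obtain ⟨a₂, ha₂, b₂, hb₂, rfl⟩ := Set.mem_mul.mp hy
      refine Set.mem_mul.mpr ⟨a₁ * a₂, Subgroup.mul_mem _ ha₁ ha₂, b₁ * b₂, Subgroup.mul_mem _ hb₁ hb₂, ?_⟩
      rw [mul_assoc, mul_assoc, ← mul_assoc a₂, hcomm a₂ ha₂ b₁ hb₁, mul_assoc]
    | inv x _ hx =>
      obtain ⟨a, ha, b, hb, rfl⟩ := Set.mem_mul.mp hx
      refine Set.mem_mul.mpr ⟨a⁻¹, Subgroup.inv_mem _ ha, b⁻¹, Subgroup.inv_mem _ hb, ?_⟩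
      rw [mul_inv_rev, hcomm a⁻¹ (Subgroup.inv_mem _ ha) b⁻¹ (Subgroup.inv_mem _ hb)]
  refine hS.of_isClosed_subset (Subgroup.isClosed_topologicalClosure _) ?_
  rw [Subgroup.topologicalClosure_coe]
  exact closure_minimal hsub hS.isClosed

namespace ProfiniteSemiGraph

/-! ### All branches of the level trees over abutting base branches abut -/

/-- A branch of a level tree `𝔾̃_n` lying over a base branch that abuts to a vertex abuts to a vertex (the
universal graph covering of the orbit graph: `univCover_abuts_of_abuts`, `orbitGraph_abuts_of_abuts`,
`glueOpt_isSome`). [cite: MochizukiSemiAnbd2006, Prop 3.6 p.38] -/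
theorem GaloisLevelData.exists_tree_abuts_eq_some {𝒢 : ProfiniteSemiGraph.{u}} (D : GaloisLevelData 𝒢) (n : ℕ)
    (β : (D.tree n).Branch) {w : 𝒢.graph.Vertex} (hw : 𝒢.graph.abuts ((D.treeProj n).branchMap β) = some w) :
    ∃ z : (D.tree n).Vertex, (D.tree n).abuts β = some z := by
  obtain ⟨⟨e, q⟩, ⟨⟨⟨b, E⟩, hE⟩, hb'⟩⟩ := β
  change 𝒢.graph.abuts b = some w at hw
  obtain ⟨V, hV⟩ := Option.isSome_iff_exists.mp ((D.S n).glueOpt_isSome b w hw E hE)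
  have h2 : (D.S n).orbitGraph.abuts ⟨(b, E), hE⟩ = some V := by
    rw [CovObj.orbitGraph_abuts_of_abuts (D.S n) b E hE w hw, hV]
  exact ⟨_, SemiGraph.univCover_abuts_of_abuts _ _ e q ⟨(b, E), hE⟩ hb' V h2⟩

variable {p : ℕ} [hp : Fact p.Prime] {h36 : (metabelianLeafStar p).Prop36Hypotheses}
  (P₀ : ((metabelianLeafStar p).galoisLevelData h36).PointSeq h36.isCountable (leafStarCentre p))

/-! ### The centraliser form: compact-generating elements commuting with `C₀ ∖ 1` lie in `C₀` -/

/-- **Every `k` generating a compact procyclic subgroup of `π₁^temp(𝒢⋆(p))` and commuting with some non-trivial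
`d ∈ ⟨c⟩‾` lies in `⟨c⟩‾`** (canonical chart; `c` the escaping element of `exists_escapeLimit`).  Steps 1–3 of
the module docstring: certificate, two-level tree bridge, compactness of `⟨k, c⟩‾` and file B2.
[cite: MochizukiSemiAnbd2006, Thm 3.7(iv) p.41] -/
theorem mem_escape_of_commute_of_mem (c : ((metabelianLeafStar p).galoisLevelData h36).temperedPi h36.isCountable)
    (N : ℕ → ℕ)
    (hcN : ∀ j k, N j ≤ k → ((metabelianLeafStar p).galoisLevelData h36).proj h36.isCountable j c =
      ((metabelianLeafStar p).galoisLevelData h36).proj h36.isCountable j (escC P₀ k))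
    (hC : IsCompact ((Subgroup.zpowers c).topologicalClosure :
      Set (((metabelianLeafStar p).galoisLevelData h36).temperedPi h36.isCountable)))
    (hact : ∀ j k, N j ≤ k → ((metabelianLeafStar p).galoisLevelData h36).treeAct h36.isCountable j c =
      ((metabelianLeafStar p).galoisLevelData h36).treeAct h36.isCountable j (escC P₀ k))
    (k d : ((metabelianLeafStar p).galoisLevelData h36).temperedPi h36.isCountable)
    (hk : IsCompact ((Subgroup.zpowers k).topologicalClosure :
      Set (((metabelianLeafStar p).galoisLevelData h36).temperedPi h36.isCountable)))
    (hd : d ∈ (Subgroup.zpowers c).topologicalClosure) (hd1 : d ≠ 1) (hkd : k * d = d * k) :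
    k ∈ (Subgroup.zpowers c).topologicalClosure := by
  classical
  let Dg := (metabelianLeafStar p).galoisLevelData h36
  have hc := h36.isCountable
  haveI : T2Space (Dg.temperedPi hc) := Dg.t2Space_temperedPi hc
  let D₀ : VerticialLevelData.{0} (metabelianLeafStar p) ((metabelianLeafStar p).temperedPiChart h36) :=
    verticialLevelData_temperedPiChart (h36 := h36)
  let C₀ : Subgroup (Dg.temperedPi hc) := (Subgroup.zpowers c).topologicalClosure
  have hcC : c ∈ C₀ := Subgroup.le_topologicalClosure _ (Subgroup.mem_zpowers c)
  -- the compact closed subgroup generated by the commuting `k`, `d`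
  have hdcpt : IsCompact ((Subgroup.zpowers d).topologicalClosure : Set (Dg.temperedPi hc)) := by
    refine hC.of_isClosed_subset (Subgroup.isClosed_topologicalClosure _) ?_
    exact (Subgroup.topologicalClosure_minimal _ ((Subgroup.zpowers_le).mpr hd)
      (Subgroup.isClosed_topologicalClosure _) : (Subgroup.zpowers d).topologicalClosure ≤ _)
  have hkd_cpt := isCompact_topologicalClosure_closure_pair_of_commute hk hdcpt hkd
  have hkKD : k ∈ (Subgroup.closure ({k, d} : Set (Dg.temperedPi hc))).topologicalClosure :=
    Subgroup.le_topologicalClosure _ (Subgroup.subset_closure (by simp))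
  have hdKD : d ∈ (Subgroup.closure ({k, d} : Set (Dg.temperedPi hc))).topologicalClosure :=
    Subgroup.le_topologicalClosure _ (Subgroup.subset_closure (by simp))
  /- Step A: at every level `m`, `ρ_m(k)` and `ρ_m(c)` have a common fixed vertex. -/
  have hcommon : ∀ m : ℕ, ∃ z : (Dg.tree m).Vertex,
      (Dg.treeAct hc m k).hom.vertexMap z = z ∧ (Dg.treeAct hc m c).hom.vertexMap z = z := by
    intro m
    by_contra hno
    push Not at hno
    -- fixed vertices of `k` and of `c` at level `m`
    obtain ⟨a₀, ha₀⟩ := D₀.exists_forall_mem_fixed_vertex_of_isCompact (Subgroup.zpowers k).topologicalClosure hk m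
    obtain ⟨b₀, hb₀⟩ := D₀.exists_forall_mem_fixed_vertex_of_isCompact C₀ hC m
    have hkK : k ∈ (Subgroup.zpowers k).topologicalClosure := Subgroup.le_topologicalClosure _ (Subgroup.mem_zpowers k)
    have ha₀k : (Dg.treeAct hc m k).hom.vertexMap a₀ = a₀ := ha₀ k hkK
    have hb₀c : (Dg.treeAct hc m c).hom.vertexMap b₀ = b₀ := hb₀ c hcC
    -- the separating edge `e₀` of level `m` (tree bridge)
    obtain ⟨e₀, he₀⟩ := SemiGraph.exists_edge_forall_walk_mem_support (Dg.isTree_tree m) (Dg.treeAct hc m k)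
      (Dg.treeAct hc m c) (fun β => Dg.exists_tree_abuts_eq_some m β rfl)
      (fun e he β hβ => SemiGraph.branchMap_eq_of_over_aut (Dg.treeProj m) (Dg.treeAct hc m k)
        (Dg.treeAct_over hc m k) β (by rw [hβ]; exact he))
      (fun e he β hβ => SemiGraph.branchMap_eq_of_over_aut (Dg.treeProj m) (Dg.treeAct hc m c)
        (Dg.treeAct_over hc m c) β (by rw [hβ]; exact he))
      ha₀k hb₀c hno
    -- its base edge `n₀` and a deep level `M ≥ m` at which `d` fixes no edge over `n₀`
    obtain ⟨M₀, hM₀⟩ := exists_level_forall_edgeMap_ne P₀ c N hcN d hd hd1 ((Dg.treeProj m).edgeMap e₀)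
    obtain ⟨M, hmM, hM₀M⟩ : ∃ M : ℕ, m ≤ M ∧ M₀ ≤ M := ⟨max m M₀, le_max_left _ _, le_max_right _ _⟩
    -- at level `M`: a common fixed vertex `v` of `k`, `d`; a vertex `w` fixed by `C₀`
    obtain ⟨v, hv⟩ := D₀.exists_forall_mem_fixed_vertex_of_isCompact
      (Subgroup.closure ({k, d} : Set (Dg.temperedPi hc))).topologicalClosure hkd_cpt M
    have hvk : (Dg.treeAct hc M k).hom.vertexMap v = v := hv k hkKD
    have hvd : (Dg.treeAct hc M d).hom.vertexMap v = v := hv d hdKD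
    obtain ⟨w, hw⟩ := D₀.exists_forall_mem_fixed_vertex_of_isCompact C₀ hC M
    have hwc : (Dg.treeAct hc M c).hom.vertexMap w = w := hw c hcC
    have hwd : (Dg.treeAct hc M d).hom.vertexMap w = w := hw d hd
    -- the geodesic `[v, w]` of `𝒢_{∞,M}` is fixed node-wise by `d`
    obtain ⟨γ, hγp, -⟩ := ((Dg.isTree_tree M).isTree.connected
      (Sum.inl v : (Dg.tree M).Node) (Sum.inl w)).exists_path_of_dist
    have hγfix : ∀ x ∈ γ.support, SemiGraph.nodeMap (Dg.treeAct hc M d) x = x :=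
      SemiGraph.nodeMap_eq_self_of_isPath (Dg.isTree_tree M).isTree.isAcyclic
        (Dg.treeAct hc M d) (by rw [SemiGraph.nodeMap_inl, hvd]) (by rw [SemiGraph.nodeMap_inl, hwd]) γ hγp
    -- push it down to level `m`: a walk from the `k`-fixed vertex `π v` to the `c`-fixed vertex `π w`
    obtain ⟨ω, hω⟩ := SemiGraph.exists_walk_nodeMap (Dg.treeTrans hmM) γ
    have hπv : (Dg.treeAct hc m k).hom.vertexMap ((Dg.treeTrans hmM).vertexMap v) = (Dg.treeTrans hmM).vertexMap v := by
      have h : (Dg.treeTrans hmM).vertexMap ((Dg.treeAct hc M k).hom.vertexMap v) =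
          (Dg.treeAct hc m k).hom.vertexMap ((Dg.treeTrans hmM).vertexMap v) := D₀.trans_act_vertexMap hmM k v
      rw [hvk] at h
      exact h.symm
    have hπw : (Dg.treeAct hc m c).hom.vertexMap ((Dg.treeTrans hmM).vertexMap w) = (Dg.treeTrans hmM).vertexMap w := by
      have h : (Dg.treeTrans hmM).vertexMap ((Dg.treeAct hc M c).hom.vertexMap w) =
          (Dg.treeAct hc m c).hom.vertexMap ((Dg.treeTrans hmM).vertexMap w) := D₀.trans_act_vertexMap hmM c w
      rw [hwc] at h
      exact h.symm
    -- the bridge: the walk passes through the edge-point `e₀`, i.e. some edge `eM` of `[v, w]` lies over `e₀`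
    have hmem : (Sum.inr (Sum.inl e₀) : (Dg.tree m).Node) ∈ ω.support := he₀ _ _ hπv hπw ω
    rw [hω, List.mem_map] at hmem
    obtain ⟨x, hx, hxe⟩ := hmem
    obtain ⟨eM, rfl, heM⟩ := (SemiGraph.Hom.nodeMap_eq_edge_iff _ x e₀).mp hxe
    -- `eM` is fixed by `d` and lies over the base edge `n₀` of `e₀`
    have heMfix : (Dg.treeAct hc M d).hom.edgeMap eM = eM := by
      simpa only [SemiGraph.nodeMap_inr_inl, Sum.inr.injEq, Sum.inl.injEq] using hγfix _ hx
    have heMn : (Dg.treeProj M).edgeMap eM = (Dg.treeProj m).edgeMap e₀ := by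
      have h := congrArg (fun φ => SemiGraph.Hom.edgeMap φ eM) (Dg.treeTrans_over hmM)
      simp only [SemiGraph.comp_edgeMap, Function.comp_apply, heM] at h
      exact h.symm
    -- its branch over `(n₀, true)` abuts to a centre-type vertex `(a · P₀).vertex M`
    obtain ⟨β, hβeM, hβb⟩ := SemiGraph.Hom.exists_branchMap_eq (Dg.treeProj M) eM
      (((Dg.treeProj m).edgeMap e₀, true) : ℕ × Bool) (by rw [heMn]; rfl)
    obtain ⟨z, hz⟩ := Dg.exists_tree_abuts_eq_some M β (w := leafStarCentre p) (by rw [hβb]; rfl)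
    have hzc : (Dg.treeProj M).vertexMap z = leafStarCentre p := by
      have h := (Dg.treeProj M).abuts_branchMap β z hz
      rw [hβb] at h
      change some (leafStarCentre p) = some _ at h
      exact (Option.some.inj h).symm
    obtain ⟨a, ha⟩ := P₀.exists_smul_vertex_eq M z hzc
    -- contradiction with the certificate
    exact hM₀ M hM₀M a β hβb (by rw [ha]; exact hz) (by rw [hβeM]; exact heMfix)
  /- Step B: `⟨k, c⟩‾` has finite level images, is compact, contains `C₀`, hence equals `C₀`. -/
  let K' : Subgroup (Dg.temperedPi hc) := (Subgroup.closure ({k, c} : Set (Dg.temperedPi hc))).topologicalClosure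
  have hfin : ∀ m, (Dg.proj hc m '' (K' : Set (Dg.temperedPi hc))).Finite := by
    intro m
    obtain ⟨z, hzk, hzc⟩ := hcommon m
    obtain ⟨T, hT⟩ : ∃ T : Dg.PointSeq hc ((Dg.treeProj m).vertexMap z), T.vertex m = z :=
      exists_pointSeq_vertex_eq_galoisLevelData h36 m z
    -- the finite image `R` of the decomposition group `ψ_T(Π_w)` at level `m`
    let R : Subgroup (Dg.Gal hc m) := (T.decompHom.range).map (Dg.proj hc m)
    have hRfin : (R : Set (Dg.Gal hc m)).Finite := by
      have h2 : IsCompact (Dg.proj hc m '' Set.range T.decompHom) :=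
        (isCompact_range T.continuous_decompHom).image (Dg.continuous_proj hc m)
      have h3 : (R : Set (Dg.Gal hc m)) = Dg.proj hc m '' Set.range T.decompHom := by
        change (((T.decompHom.range).map (Dg.proj hc m) : Subgroup (Dg.Gal hc m)) : Set (Dg.Gal hc m)) = _
        rw [Subgroup.coe_map, MonoidHom.coe_range]
      exact h3 ▸ h2.finite_of_discrete
    have hmemR : ∀ g : Dg.temperedPi hc, (Dg.treeAct hc m g).hom.vertexMap z = z → Dg.proj hc m g ∈ R := by
      intro g hg
      rw [← hT] at hg
      obtain ⟨kk, hkk⟩ := (T.fixes_vertex_iff_exists_gal m g).mp hg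
      exact Subgroup.mem_map.mpr ⟨T.decompHom kk, ⟨kk, rfl⟩, (T.proj_decompHom m kk).trans hkk⟩
    have hle : (Subgroup.closure ({k, c} : Set (Dg.temperedPi hc))).map (Dg.proj hc m) ≤ R := by
      rw [Subgroup.map_le_iff_le_comap, Subgroup.closure_le]
      intro x hx
      rcases hx with rfl | rfl
      · exact hmemR _ hzk
      · exact hmemR _ hzc
    refine hRfin.subset ?_
    rintro _ ⟨x, hx, rfl⟩
    have h1 := image_closure_subset_closure_image (Dg.continuous_proj hc m)
      ⟨x, (by rw [← Subgroup.topologicalClosure_coe]; exact hx), rfl⟩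
    rw [(isClosed_discrete _).closure_eq] at h1
    obtain ⟨x', hx'', hxx'⟩ := h1
    exact hxx' ▸ hle (Subgroup.mem_map.mpr ⟨x', hx'', rfl⟩)
  have hK'c : IsCompact (K' : Set (Dg.temperedPi hc)) :=
    Dg.isCompact_of_isClosed_of_forall_finite_image hc (K' : Set (Dg.temperedPi hc))
      (Subgroup.isClosed_topologicalClosure _) hfin
  have hCK' : (Subgroup.zpowers c).topologicalClosure ≤ K' :=
    Subgroup.topologicalClosure_mono ((Subgroup.zpowers_le).mpr (Subgroup.subset_closure (by simp)))
  have hkK' : k ∈ K' := Subgroup.le_topologicalClosure _ (Subgroup.subset_closure (by simp))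
  exact le_escape_of_isCompact_of_ge P₀ c N hcN hact K' hK'c hCK' hkK'

/-! ### Compact subgroups meeting `C₀` non-trivially -/

/-- **Every compact subgroup `K` of `π₁^temp(𝒢⋆(p))` with `K ⊓ ⟨c⟩‾ ≠ 1` is contained in `⟨c⟩‾`** (canonical
chart).  `K` is not inside a verticial subgroup (the escaping `⟨c⟩‾` is anchor-free), hence commutative
(abc-iut-w6-d064's dichotomy), and `mem_escape_of_commute_of_mem` applies to each `k ∈ K` and some
`d ∈ K ⊓ ⟨c⟩‾ ∖ 1`. [cite: MochizukiSemiAnbd2006, Thm 3.7(iv) p.41] -/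
theorem le_escape_of_isCompact_of_inf_ne_bot (c : ((metabelianLeafStar p).galoisLevelData h36).temperedPi h36.isCountable)
    (N : ℕ → ℕ)
    (hcN : ∀ j k, N j ≤ k → ((metabelianLeafStar p).galoisLevelData h36).proj h36.isCountable j c =
      ((metabelianLeafStar p).galoisLevelData h36).proj h36.isCountable j (escC P₀ k))
    (hC : IsCompact ((Subgroup.zpowers c).topologicalClosure :
      Set (((metabelianLeafStar p).galoisLevelData h36).temperedPi h36.isCountable)))
    (hact : ∀ j k, N j ≤ k → ((metabelianLeafStar p).galoisLevelData h36).treeAct h36.isCountable j c =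
      ((metabelianLeafStar p).galoisLevelData h36).treeAct h36.isCountable j (escC P₀ k))
    (K : Subgroup ((metabelianLeafStar p).temperedPiChart h36).G)
    (hKc : IsCompact (K : Set ((metabelianLeafStar p).temperedPiChart h36).G))
    (hK : K ⊓ (Subgroup.zpowers c).topologicalClosure ≠ ⊥) :
    K ≤ (Subgroup.zpowers c).topologicalClosure := by
  haveI : T2Space (((metabelianLeafStar p).galoisLevelData h36).temperedPi h36.isCountable) :=
    ((metabelianLeafStar p).galoisLevelData h36).t2Space_temperedPi h36.isCountable
  haveI : T2Space ((metabelianLeafStar p).temperedPiChart h36).G :=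
    ((metabelianLeafStar p).galoisLevelData h36).t2Space_temperedPi h36.isCountable
  obtain ⟨d, hdmem, hd1⟩ : ∃ d ∈ K ⊓ (Subgroup.zpowers c).topologicalClosure, d ≠ 1 := by
    by_contra h
    push Not at h
    exact hK ((Subgroup.eq_bot_iff_forall _).mpr h)
  obtain ⟨hdK, hdC⟩ := Subgroup.mem_inf.mp hdmem
  rcases metabelianLeafStar_le_verticial_or_commutative p ((metabelianLeafStar p).temperedPiChart h36) K hKc with
      ⟨v, H, hH, hKH⟩ | hcomm
  · -- `K ≤ H` verticial: then `d ∈ ⟨c⟩‾ ⊓ H = 1` — the escaping compact is anchor-free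
    exfalso
    have hbot := metabelianLeafStar_inf_verticial_eq_bot_of_forall_not_le p ((metabelianLeafStar p).temperedPiChart h36)
      ((Subgroup.zpowers c).topologicalClosure) hC (fun v H hH => escapeLimit_not_le_verticial P₀ c N hcN hact hH) hH
    have hd' : d ∈ ((Subgroup.zpowers c).topologicalClosure ⊓ H :
        Subgroup ((metabelianLeafStar p).temperedPiChart h36).G) := Subgroup.mem_inf.mpr ⟨hdC, hKH hdK⟩
    exact hd1 ((Subgroup.eq_bot_iff_forall _).mp hbot d hd')
  · intro k hk
    -- read `k`, `K` in the tower's group `π₁^temp = lim_n Gal(𝒢_{∞,n}/𝒢)` (the chart's group, definitionally)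
    obtain ⟨k₁, rfl⟩ : ∃ k₁ : ((metabelianLeafStar p).galoisLevelData h36).temperedPi h36.isCountable, k₁ = k :=
      ⟨k, rfl⟩
    obtain ⟨K₁, rfl⟩ :
        ∃ K₁ : Subgroup (((metabelianLeafStar p).galoisLevelData h36).temperedPi h36.isCountable), K₁ = K := ⟨K, rfl⟩
    have hKc₁ : IsCompact ((K₁ : Set (((metabelianLeafStar p).galoisLevelData h36).temperedPi h36.isCountable))) := hKc
    have hk₁ : k₁ ∈ K₁ := hk
    have hkcpt : IsCompact ((Subgroup.zpowers k₁).topologicalClosure :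
        Set (((metabelianLeafStar p).galoisLevelData h36).temperedPi h36.isCountable)) := by
      refine hKc₁.of_isClosed_subset (Subgroup.isClosed_topologicalClosure _) ?_
      exact (Subgroup.topologicalClosure_minimal _ (Subgroup.zpowers_le.mpr hk₁) hKc₁.isClosed :
        (Subgroup.zpowers k₁).topologicalClosure ≤ K₁)
    exact mem_escape_of_commute_of_mem P₀ c N hcN hC hact k₁ d hkcpt hdC hd1 (hcomm k₁ hk d hdK)

/-- **`⟨c⟩‾` is the ONLY maximal compact subgroup meeting `⟨c⟩‾` non-trivially** (gen 7's banked question,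
answered YES): a maximal compact `K` with `K ⊓ ⟨c⟩‾ ≠ 1` equals `⟨c⟩‾`. [cite: MochizukiSemiAnbd2006, Thm 3.7(iv) p.41] -/
theorem eq_escape_of_isMaximalCompactSubgroup_of_inf_ne_bot
    (c : ((metabelianLeafStar p).galoisLevelData h36).temperedPi h36.isCountable) (N : ℕ → ℕ)
    (hcN : ∀ j k, N j ≤ k → ((metabelianLeafStar p).galoisLevelData h36).proj h36.isCountable j c =
      ((metabelianLeafStar p).galoisLevelData h36).proj h36.isCountable j (escC P₀ k))
    (hC : IsCompact ((Subgroup.zpowers c).topologicalClosure :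
      Set (((metabelianLeafStar p).galoisLevelData h36).temperedPi h36.isCountable)))
    (hact : ∀ j k, N j ≤ k → ((metabelianLeafStar p).galoisLevelData h36).treeAct h36.isCountable j c =
      ((metabelianLeafStar p).galoisLevelData h36).treeAct h36.isCountable j (escC P₀ k))
    (K : Subgroup ((metabelianLeafStar p).temperedPiChart h36).G) (hK : IsMaximalCompactSubgroup K)
    (hKC : K ⊓ (Subgroup.zpowers c).topologicalClosure ≠ ⊥) :
    K = (Subgroup.zpowers c).topologicalClosure :=
  (hK.2 _ hC (le_escape_of_isCompact_of_inf_ne_bot P₀ c N hcN hC hact K hK.1 hKC)).symm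

/-- **[SemiAnbd] Thm 3.7 (iv), second sentence, AT THE EXOTIC WITNESS**: a maximal compact subgroup of
`π₁^temp(𝒢⋆(p))` different from `⟨c⟩‾` meets `⟨c⟩‾` TRIVIALLY — no non-trivial subgroup of `⟨c⟩‾` is "a
nontrivial intersection of distinct maximal compact subgroups". [cite: MochizukiSemiAnbd2006, Thm 3.7(iv) p.41] -/
theorem inf_escape_eq_bot_of_isMaximalCompactSubgroup_of_ne
    (c : ((metabelianLeafStar p).galoisLevelData h36).temperedPi h36.isCountable) (N : ℕ → ℕ)
    (hcN : ∀ j k, N j ≤ k → ((metabelianLeafStar p).galoisLevelData h36).proj h36.isCountable j c =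
      ((metabelianLeafStar p).galoisLevelData h36).proj h36.isCountable j (escC P₀ k))
    (hC : IsCompact ((Subgroup.zpowers c).topologicalClosure :
      Set (((metabelianLeafStar p).galoisLevelData h36).temperedPi h36.isCountable)))
    (hact : ∀ j k, N j ≤ k → ((metabelianLeafStar p).galoisLevelData h36).treeAct h36.isCountable j c =
      ((metabelianLeafStar p).galoisLevelData h36).treeAct h36.isCountable j (escC P₀ k))
    (K : Subgroup ((metabelianLeafStar p).temperedPiChart h36).G) (hK : IsMaximalCompactSubgroup K)
    (hne : K ≠ (Subgroup.zpowers c).topologicalClosure) :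
    K ⊓ (Subgroup.zpowers c).topologicalClosure = ⊥ := by
  by_contra h
  exact hne (eq_escape_of_isMaximalCompactSubgroup_of_inf_ne_bot P₀ c N hcN hC hact K hK h)

variable (p)

/-- **`π₁^temp(𝒢⋆(p))` has an ISOLATED exotic maximal compact subgroup** (canonical chart, every prime `p`,
hypothesis-free): a maximal compact `C₀ = ⟨c⟩‾`, lying in NO verticial subgroup, such that every compact subgroup
meeting `C₀` non-trivially lies in `C₀`, every other maximal compact subgroup meets `C₀` trivially, and every
compact-generating element commuting with a non-trivial element of `C₀` lies in `C₀`.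
[cite: MochizukiSemiAnbd2006, Thm 3.7(iv) p.41] -/
theorem metabelianLeafStar_exists_isolated_exotic_maximalCompact (h36 : (metabelianLeafStar p).Prop36Hypotheses) :
    ∃ c : ((metabelianLeafStar p).temperedPiChart h36).G,
      IsMaximalCompactSubgroup
          ((Subgroup.zpowers c).topologicalClosure : Subgroup ((metabelianLeafStar p).temperedPiChart h36).G) ∧
      (∀ (v : (metabelianLeafStar p).graph.Vertex) (H : Subgroup ((metabelianLeafStar p).temperedPiChart h36).G),
        H ∈ verticialSubgroups ((metabelianLeafStar p).temperedPiChart h36) v →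
          ¬ (Subgroup.zpowers c).topologicalClosure ≤ H) ∧
      (∀ K : Subgroup ((metabelianLeafStar p).temperedPiChart h36).G,
        IsCompact (K : Set ((metabelianLeafStar p).temperedPiChart h36).G) →
          K ⊓ (Subgroup.zpowers c).topologicalClosure ≠ ⊥ → K ≤ (Subgroup.zpowers c).topologicalClosure) ∧
      (∀ K : Subgroup ((metabelianLeafStar p).temperedPiChart h36).G, IsMaximalCompactSubgroup K →
        K ≠ (Subgroup.zpowers c).topologicalClosure → K ⊓ (Subgroup.zpowers c).topologicalClosure = ⊥) ∧
      ∀ k d : ((metabelianLeafStar p).temperedPiChart h36).G,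
        IsCompact ((Subgroup.zpowers k).topologicalClosure : Set ((metabelianLeafStar p).temperedPiChart h36).G) →
          d ∈ (Subgroup.zpowers c).topologicalClosure → d ≠ 1 → k * d = d * k →
            k ∈ (Subgroup.zpowers c).topologicalClosure := by
  obtain ⟨P₀⟩ := GaloisLevelData.nonempty_pointSeq h36 (leafStarCentre p)
  obtain ⟨c, N, hcN, hC, hact⟩ := exists_escapeLimit P₀
  obtain ⟨hmax, hno⟩ := escape_isMaximalCompactSubgroup P₀ c N hcN hC hact
  exact ⟨c, hmax, hno, fun K hKc hK => le_escape_of_isCompact_of_inf_ne_bot P₀ c N hcN hC hact K hKc hK,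
    fun K hK hne => inf_escape_eq_bot_of_isMaximalCompactSubgroup_of_ne P₀ c N hcN hC hact K hK hne,
    fun k d hk hd hd1 hkd => mem_escape_of_commute_of_mem P₀ c N hcN hC hact k d hk hd hd1 hkd⟩

end ProfiniteSemiGraph

end Literature.AnabelianGeometry.SemiGraphs

end
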